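import Summits.QuantumFields.YangMills.Theses.ThermalDescent

/-!
# ThermalDescent — glue of the HypercubeSeam split (gen 1)

`TransportIdentity → OddTorusRP → HypercubeSeam` (item stmt-QuantumFields-27344, decl `HypercubeSeamGlue`, route file
rev 5, commit 2170c9be1a4e): `2·Q2 = 2·Qrp + 2·Cov(D∘refl, B) ≥ 2·Qrp − (Qrp + Drp) = Qrp − Drp`, linear arithmetic
through the shared verbatim `let`-chain.  This is the registered skeleton's composition
(`Cruxes/NT/Lines/thermal_descent_seam_birth.lean` @91f259e3f722) with the two stubs as hypotheses.
-/

namespace Summit.QuantumFields.YangMills.Theorems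

open Summit.QuantumFields.YangMills.Theses.ThermalDescent in -- route file rev 5 (commit 2170c9be1a4e)
/-- The glue item of the HypercubeSeam split. -/
theorem thermalDescent_hypercubeSeamGlue :
    Summit.QuantumFields.YangMills.Theses.ThermalDescent.HypercubeSeamGlue := by
  intro hT hR G _ _ _ _ hG r
  dsimp only
  intro β L s v δ₁ δ₂ hβ hL hs hδ₁ hsupp hsz
  have h1 := hT G hG r β L s v δ₁ δ₂ hβ hL hs hδ₁ hsupp hsz
  have h2 := hR G hG r β L s v δ₁ δ₂ hβ hL hs hδ₁ hsupp hsz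
  dsimp only at h1 h2
  linarith

end Summit.QuantumFields.YangMills.Theorems
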